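import Literature.NumberTheory.LFunctions.DirichletLTruncationPacked
import Literature.NumberTheory.LFunctions.FeketePolyaKernelSignTablesWide
import HarnessLib

/-!
# Packed truncation certificate data for the conductor `13340` (cell group 1 of 3)

Kernel evaluation (`decide +kernel`) of one piece of the packed truncation certificate (Chua's ALGO 1, `K = 16` periods,
`G = 128`, `E = 2^11`, `P = 40`, digit width `72`) for the even primitive quadratic character of conductor `13340 = 4·5·23·29`
(`B⁻ = 2884`); consumed by the soundness theorem of `LTruncationPacked.certTcells` / `certTframe`.
[cite: Chua2005RealZeros, §2.2 ALGO 1]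
-/

namespace Literature.NumberTheory.LFunctions

namespace LTruncationPacked

open FeketePolyaKernel

set_option maxHeartbeats 0 in
/-- cell group 1 of 3: the check passes. [cite: Chua2005RealZeros, §2.2 ALGO 1] -/
theorem certTcells_13340_1 :
    certTcells 72 40 11 128 13340 16 2884
      [(1024, 1), (1025, 1), (1026, 1), (1027, 1), (1028, 1), (1029, 1), (1030, 1), (1031, 1), (1032, 1), (1033, 1), (1034, 1), (1035, 2), (1037, 2), (1039, 2), (1041, 2), (1043, 2), (1045, 2), (1047, 2), (1049, 2), (1051, 2), (1053, 2), (1055, 2), (1057, 2)]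
      (plainTabsC 1 72 47 [5, 23, 29] 13340) = true := by
  decide +kernel

end LTruncationPacked

end Literature.NumberTheory.LFunctions
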